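import Mathlib
import Literature.Analysis.FluidPDE.KNSSLineInvariantLiouville
import Literature.Analysis.FluidPDE.BlowupAncientSolution
import HarnessLib
/-!
# The inner limit in Case B is constant in space (zone Z1 TEMPLATE §T1.4-I (I-3)/(I-4), kernel-checked)

HONEST FRAMING (cell ns-blowup GROUP B «PROFILE SEARCH», zone Z1 «Type-II log-modulated DSS ansatz for axisymmetric
Navier–Stokes — the template IS the deliverable»; D-0035/D-0074): part XIV of the Z1 dictionary. TEMPLATE (I-3) «GEOMETRY
OF THE LIMIT»: «Case B (`d_n → ∞`): `W` is invariant under translations along one horizontal direction (rings of rescaled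
radius `d_n → ∞` are locally straight), i.e. a bounded ancient mild ‹2½-D› solution; KNSS Thm 5.1 … applied to the
in-plane part and the heat-with-constant-drift Liouville theorem for the third component give `W ≡ const`. So a
NON-constant inner limit can only arise in Case A». This step was listed PAPER in every decl table so far (§T1.19 (K12),
§T1.20 (K17), §T1.21 (K20): «(I-3) Case-B geometry (compactness / Liouville — … the passage ‹locally straight rings ⇒
translation-invariant limit› is paper)»). The Liouville half is now a tree theorem —
`Literature.Analysis.FluidPDE.apply_eq_apply_zero_of_lineInvariant` (`KNSSLineInvariantLiouville`, this seat, 2026-08-27: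
a bounded ancient mild solution in the duality class at `ν = 1`, jointly continuous on `(−∞, 0) × ℝ³` and invariant under
`x ↦ x + δe₁`, satisfies `u(t, x) = u(t, 0)` for all `t < 0`; composed from the DISCHARGED `KNSS2009_liouville_planar_holds`
(Thm 5.1) through the descent lemma, `KNSS2009_regularity_boundedWeak_ancient_holds` (§4) and
`KNSS2009_lemma21_halfball_holds` (Lemma 2.1) — the third component is handled by Lemma 2.1 on `±∂₀U₁`, `±∂₂U₁` and
incompressibility rather than by a heat Liouville theorem) — and this file reads it on the TEMPLATE's inner object, the
KNSS blow-up limit `Literature.Analysis.FluidPDE.IsKNSSBlowupLimit` of (I-2) (smooth bounded ancient mild, `|W| ≤ 1 = sup|W|`):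

* `innerLimit_apply_eq_of_lineInvariant` / `knssBlowupLimit_apply_eq_of_lineInvariant` — **Case B ⇒ every slice of the
  inner limit is a constant vector** (`W(s, y) = W(s, 0)`);
* `knssBlowupLimit_curl_eq_zero_of_lineInvariant` — hence it carries NO vorticity: the Case-B object is of the degenerate
  type (I-4)(α) (all vorticity at amplitude `o(‖u‖²_∞)`), never of type (β);
* `knssBlowupLimit_caseB` — the full Case-B description: constant slices `c(s)` with `‖c(s)‖ ≤ 1` and `sup_s ‖c(s)‖ = 1`;
* `knssBlowupLimit_not_lineInvariant_of_not_const` — **the dichotomy of record: an inner limit with one non-constant slice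
  is NOT invariant along `e₁`** — a type-(β) object arises only in Case A (velocity maximum within `O(λ)` of the axis,
  catalogue (C6));
* `axL_conclusion_of_lineInvariant` — the conclusion of the OPEN `Summit.NavierStokesRegularity.NavierStokesRegularity.
  AxisymmetricLiouvilleBoundedSwirl` (`∀ t < 0, ∃ b, u t =ᵐ[volume] fun _ => b`) HOLDS on the degenerate class of
  jointly continuous `e₁`-invariant solutions, with no axisymmetry and no swirl hypothesis.

What stays PAPER of (I-3): the compactness passage «`d_n → ∞` ⇒ the limit of the horizontally re-centred zoom is invariant
along the tangent direction» (it needs the KNSS extraction `KNSS2009_blowup_generates_ancient_holds` run with off-axis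
centres and the axisymmetry of the pre-limit fields; cf. `Literature.Analysis.FluidPDE.leiRenZhang2019_sliding`). **Nothing
here asserts that a blow-up, a convergent zoom or a non-trivial inner object exists**: IF the inner limit is invariant along
`e₁`, it is constant in space. «violates: n/a — dictionary»; bears_on LADDER-NS N5/Z1 → N1 linear core / N0⁻ ((I-3)/(C6)).
Author: ns-blowup-profile-eng-1 g7, 2026-08-27.
-/

open Real Filter Topology Set MeasureTheory Function
open Literature.Analysis.FluidPDE

namespace Summit.NavierStokesRegularity.OSWSelfSimilar
namespace TypeIIModulationDictionary

section CaseB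

variable {W : ℝ → EuclideanSpace ℝ (Fin 3) → EuclideanSpace ℝ (Fin 3)}

/-- **TEMPLATE (I-3), Case B ⇒ the inner limit is constant in space** (general form): a bounded ancient mild solution
(`ν = 1`, duality class) which is jointly continuous on `(−∞, 0) × ℝ³` and invariant under the translations along `e₁`
has constant slices, `W(s, y) = W(s, 0)` — the tree's `apply_eq_apply_zero_of_lineInvariant` (KNSS 2009 Thm 5.1 + §4 +
Lemma 2.1, all discharged). [new here — dictionary] -/
theorem innerLimit_apply_eq_of_lineInvariant (hW : IsBoundedAncientMildSolution 1 W)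
    (hcont : ContinuousOn (uncurry W) (Iio 0 ×ˢ univ))
    (hinv : ∀ s < 0, ∀ (y : EuclideanSpace ℝ (Fin 3)) (δ : ℝ), W s (y + EuclideanSpace.single 1 δ) = W s y) :
    ∀ s < 0, ∀ y : EuclideanSpace ℝ (Fin 3), W s y = W s 0 :=
  apply_eq_apply_zero_of_lineInvariant hW hcont hinv

/-- **TEMPLATE (I-3), Case B, for the inner object of (I-2)**: a KNSS blow-up limit (`IsKNSSBlowupLimit`: smooth bounded
ancient mild solution with `|W| ≤ 1 = sup |W|`) which is invariant under the translations along `e₁` has constant slices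
(joint continuity is part of the class: `IsKNSSBlowupLimit.smooth`). [new here — dictionary] -/
theorem knssBlowupLimit_apply_eq_of_lineInvariant (hW : IsKNSSBlowupLimit W)
    (hinv : ∀ s < 0, ∀ (y : EuclideanSpace ℝ (Fin 3)) (δ : ℝ), W s (y + EuclideanSpace.single 1 δ) = W s y) :
    ∀ s < 0, ∀ y : EuclideanSpace ℝ (Fin 3), W s y = W s 0 :=
  apply_eq_apply_zero_of_lineInvariant hW.isBoundedAncientMildSolution hW.smooth.continuousOn hinv

/-- **Case B carries no vorticity**: the vorticity of an `e₁`-invariant KNSS blow-up limit vanishes identically — the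
Case-B inner object is of the degenerate type (I-4)(α), never a type-(β) counterexample to (AX-L). [new here — dictionary] -/
theorem knssBlowupLimit_curl_eq_zero_of_lineInvariant (hW : IsKNSSBlowupLimit W)
    (hinv : ∀ s < 0, ∀ (y : EuclideanSpace ℝ (Fin 3)) (δ : ℝ), W s (y + EuclideanSpace.single 1 δ) = W s y) :
    ∀ s < 0, ∀ y : EuclideanSpace ℝ (Fin 3), curl (W s) y = 0 := by
  intro s hs y
  have hc : W s = fun _ => W s 0 := funext (knssBlowupLimit_apply_eq_of_lineInvariant hW hinv s hs)
  rw [hc, curl_eq_curlCLM, fderiv_const_apply, map_zero]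

/-- **The Case-B object, completely**: the slices of an `e₁`-invariant KNSS blow-up limit are constant vectors `c(s)` with
`‖c(s)‖ ≤ 1`, and `sup_s ‖c(s)‖ = 1` (values above `1 − ε` occur for every `ε > 0`): an «increasingly uniform stream»
in the words of (I-4)(α). [new here — dictionary] -/
theorem knssBlowupLimit_caseB (hW : IsKNSSBlowupLimit W)
    (hinv : ∀ s < 0, ∀ (y : EuclideanSpace ℝ (Fin 3)) (δ : ℝ), W s (y + EuclideanSpace.single 1 δ) = W s y) :
    (∀ s < 0, ∃ c : EuclideanSpace ℝ (Fin 3), ‖c‖ ≤ 1 ∧ ∀ y, W s y = c) ∧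
      ∀ ε : ℝ, 0 < ε → ∃ s < 0, 1 - ε < ‖W s 0‖ := by
  have h := knssBlowupLimit_apply_eq_of_lineInvariant hW hinv
  refine ⟨fun s hs => ⟨W s 0, hW.norm_le_one s hs 0, h s hs⟩, fun ε hε => ?_⟩
  obtain ⟨s, hs, y, hy⟩ := hW.exists_lt_norm ε hε
  exact ⟨s, hs, by rwa [h s hs y] at hy⟩

/-- **The dichotomy of record (TEMPLATE (I-3) last sentence / (C6)): a non-trivial inner limit arises only in Case A.**
A KNSS blow-up limit with ONE non-constant slice is not invariant under the translations along `e₁`. [new here — dictionary] -/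
theorem knssBlowupLimit_not_lineInvariant_of_not_const (hW : IsKNSSBlowupLimit W)
    (hnc : ∃ s < 0, ∃ y : EuclideanSpace ℝ (Fin 3), W s y ≠ W s 0) :
    ¬ ∀ s < 0, ∀ (y : EuclideanSpace ℝ (Fin 3)) (δ : ℝ), W s (y + EuclideanSpace.single 1 δ) = W s y :=
  not_lineInvariant_of_not_const hW.isBoundedAncientMildSolution hW.smooth.continuousOn hnc

end CaseB

/-- **The conclusion of (AX-L) holds on the degenerate class.** For every bounded ancient mild solution (`ν = 1`, duality
class — the class of the OPEN `Summit.NavierStokesRegularity.NavierStokesRegularity.AxisymmetricLiouvilleBoundedSwirl`)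
which is jointly continuous on `(−∞, 0) × ℝ³` and invariant under `x ↦ x + δe₁`, the conjecture's conclusion
`∀ t < 0, ∃ b, u t =ᵐ[volume] fun _ => b` holds — with NO axisymmetry and NO swirl hypothesis (the tree's
`ae_eq_const_of_lineInvariant`). The genuine (AX-L) problem (Case A) is untouched. [new here — dictionary] -/
theorem axL_conclusion_of_lineInvariant (u : ℝ → EuclideanSpace ℝ (Fin 3) → EuclideanSpace ℝ (Fin 3))
    (hu : IsBoundedAncientMildSolution 1 u) (hcont : ContinuousOn (uncurry u) (Iio 0 ×ˢ univ))
    (hinv : ∀ t < 0, ∀ (x : EuclideanSpace ℝ (Fin 3)) (δ : ℝ), u t (x + EuclideanSpace.single 1 δ) = u t x) :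
    ∀ t < 0, ∃ b : EuclideanSpace ℝ (Fin 3), u t =ᵐ[volume] fun _ => b :=
  ae_eq_const_of_lineInvariant hu hcont hinv

end TypeIIModulationDictionary
end Summit.NavierStokesRegularity.OSWSelfSimilar
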